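import Summits.QuantumFields.BalabanUV.Beta.GAN24.PushRowCoarseWard
import Summits.QuantumFields.BalabanUV.Beta.GAN24.RespStepBmDecompExact
import Summits.QuantumFields.BalabanUV.Beta.GAN24.RespStepBmDecomp

/-!
# `BalabanUV.Beta.GAN24.PushRowCoarseWardChain` — binder row G-an2-4 ∕ (CONV-C), W-slot CT-W, route «WC-TL» ∕ «QR-LL», the (LT) row ∕ Q-g30-1 (the OWNER gan24-p1
# g30's W4 (3), leaf-03 g63's «PAIR-COARSE» law), PART 2 of leaf-01 g69's «ROW-WARD»: **THE DEPTH-`k` TRANSPORTED LETTER** — the (DIV)∕(DL) tower's actual objects,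
# `transport unitStepMap m (k+1) S κ u = L^{3(d+1)} • push₃ T T T S κ u`, `T = legChain (respStepBmSeq ρ Lc) m k`, `L = Lc^{k+1}`
# (`WardRemainderTransportedLetter.transport_unitStepMap_eq_cubic_push₃`) — **HAS COARSE ROW CODIFFERENTIAL `L^{−(d+1)} ×` THE GAUGE-LEFT CELL OF THE
# COMPOSITE-BLOCK INDICATOR `push₃ (dz 𝟙_{B_L(y)}) T T S`: the dressed leg CHAIN obeys the coarse Ward law with the datum `L^{−(d+1)}·gaugeWt L y`,
# level-free in `m`, geometric in the depth** (G-an2-4 formalisation swarm → CRUX TEAM (2), leaf prover `b2b-balaban-gan24-formalise-leaf-01`, gen 69, INTENT 2)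

NOT IN PRINT; OUR BOOKKEEPING ([folklore]: PART 1 `PushRowCoarseWard.codiff₁_push₃_row_eq_smul_of_ward` (the row codifferential of a push is the push with the
codifferentiated left leg) fed with leaf-01 g57's `RespStepBmDecompExact.legAct_legChain_dz` (an exact datum through the chain of dressed one-step legs, NO decay hypothesis:
`legAct (legChain D m k) (dz ψ) = (Lc^{(d+1)(k+1)})⁻¹ • dz (ψ ∘ blk (Lc^(k+1)))`) at the indicator potential `ψ = 𝟙_{y}`; leaf-17's `Push4Iter.legDecay_legChain` +
`RespStepBmDecomp.legDecay_respStepBm_levels` for the summable class (the only place the levelwise decay `hD` enters); generic `d`; 0 `def`, 0 cited facts, 0 `def … : Prop`, 0 sorry).  HONEST FRAMING (cell contract, verbatim): «discharging `BetaPertH` makes Bałaban's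
UV stability UNCONDITIONAL — a real constructive-QFT result; it is NOT the continuum limit and NOT the Clay problem.»  HONEST DEPENDENCY (verbatim): «continuum YM on T⁴ ⇐
BetaPertH ∧ nine spine estimates (0/9 proved); BetaPertH ⇐ (D1) ∧ (D4) ∧ CAP+tail; G-an2-4 gates asym, D1 and NE2/3/4.»

## Why
PART 1 handled the ONE-step transported letter (depth 0).  RULING R-gan24p1-g30-1: the (DL) binder of the CoDress END is the tower of ALL depths `k ≥ 1` — the
sub-letters `T_{m,k,v}` transported over `k+1` levels through the dressed leg CHAIN `T = legChain (respStepBmSeq (toSite rr) Lc) m k` at composite blocking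
`L = Lc^{k+1}`.  Under reading (ii) of leaf-03's law (the consumer's `W` = the transported letter read as a KERNEL) the by-parts gain at depth `k` is governed by
the coarse ROW codifferential of `push₃ T T T S κ′ u′`.  The coarse Ward datum of ANY leg family is its action on the gauge of the point indicator (§1,
hypothesis-free), and the dressed chain transports exact data EXACTLY (`legAct_legChain_dz`), so the chain's datum is `L^{−(d+1)}·gaugeWt L y` — the pure gauge of
the indicator of the COMPOSITE block `B_L(y)` with the geometric factor `L^{−(d+1)} = (Lc^{−(d+1)})^{k+1}` (§2); PART 1 §2 then gives the row codifferential of the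
depth-`k` letter as `L^{−(d+1)} ×` a gauge-left cell whose left leg lives on the bonds crossing `∂B_L(y)` (§3), and its `Lc`-block sum — the right side of leaf-03's
step law at the consumer's level `m+k+1` for `W :=` this letter — in §4.

## What (generic `d`; `[NeZero Lc]`; in-block root `toSite rr`; in §3–§4 `hD`: every UNDRESSED one-step response family `respStep (Lc^j) (Lc^(j+1))` localised at a
## positive rate — the levelwise hypothesis of `RespStepBmDecomp` ∕ `Push4Iter` (the K-slot's `UniformDecays`), displayed, used only for the summable class)
* §1 **`sum_sub_eq_legAct_dz_indicator`** (hypothesis-free): `Σ_α (l α (y − e_α) κ u − l α y κ u) = legAct l (dz 𝟙_{y}) κ u` — the coarse Ward datum of a leg family is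
  its action on the gauge of the point indicator; `dz_indicator_comp_blk_eq_gaugeWt`: `dz (𝟙_{y} ∘ blk L) = gaugeWt L y`.
* §2 **`sum_legChain_sub_eq_gaugeWt`** (hypothesis-free but the in-block root): `Σ_α (T α (y − e_α) κ u − T α y κ u) = (Lc^{(d+1)(k+1)})⁻¹·gaugeWt (Lc^(k+1)) y κ u`,
  `T = legChain (respStepBmSeq (toSite rr) Lc) m k` — every base level `m`, every depth `k` (at `k = 0`: PART 1 §3).
* §3 **`codiff₁_push₃_chain_row_eq`**: for `LocStencil S Cs δ` (`δ > 0`), every coarse slot `(κ′, u′)`, column `(z′, b)`, row block `y`, direction `α₀`: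
  `codiff₁ (α x ↦ push₃ T T T S κ′ u′ x z′ (inl α) b) y = (Lc^{(d+1)(k+1)})⁻¹·push₃ (fun _ ↦ gaugeWt (Lc^(k+1))) T T S κ′ u′ y z′ (inl α₀) b`;
  `codiff₁_push₃_chainLeft_row_eq` — the same with ARBITRARY right∕table legs on the summable class.
* §4 **`blockSum_codiff₁_push₃_chain_row_eq`**: `blockSum Lc (codiff₁ (row of push₃ T T T S κ′ u′ · z′ (inl ·) b)) y₀
  = (Lc^{(d+1)(k+1)})⁻¹·Σ_{v ∈ box Lc} push₃ (fun _ ↦ gaugeWt (Lc^(k+1))) T T S κ′ u′ (Lc•y₀ + toSite v) z′ (inl α₀) b` — the right side of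
  `WardPairingCoarseStep.stepScale_mul_pow_mul_codiff₁_multiplierCol_eq` (leaf-03 g63, in flight) at `W := push₃ T T T S κ′ u′`, one `rw` away (not imported here).
* §5 **`tsum_dz_mul_push₃_chain_row_eq`** (an2 g43's A-an2-g43-1 (2), journal l.47429: the field-leg term `⟨m, W^F⟩` of `ward_pairing` at `m = dz φ` is the one the
  (CONV-C) conversion leaves untouched): for bounded `φ`, `⟨dz φ, W^F_{z′,b}⟩ = (Lc^{(d+1)(k+1)})⁻¹·Σ'_y φ y·`(gauge-left cell of `𝟙_{B_L(y)}`) for `W :=` the depth-`k` letter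
  (an5's `lip0_codiff₁` ⨾ §3; the letter's row summability displayed).
Identities only: NO size of any cell, NO power of `Lc` is asserted (the gauge-left cell's left leg is supported on the `2(d+1)·L^d` bonds crossing `∂B_L(y)` — a support
FACT about `gaugeWt`, displayed in PART 1's pointer to `LayerPushGaugeLeft`, not a bound proved here); the choice of reading (i)∕(ii) and the count are an2's ∕ the OWNER's
(Q-g30-1).  Decides nothing about (Q-R) ∕ (DIV) ∕ (DL) ∕ K-LL-4′; NOTHING of (LT) ∕ (LAY) ∕ (S) ∕ «T2Shape» ∕ (hW, hWall) discharged; 0 wall binders; NEVER «G-an2-4 closed» as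
(CONV-C); NOT D1, NOT `BetaPertH`, NOT continuum, NOT Clay; not in print — our bookkeeping.  2026-08-22; no existing file touched.
-/

noncomputable section

open Finset
open scoped BigOperators
open Literature.MathematicalPhysics.QuantumFieldTheory
open Literature.MathematicalPhysics.QuantumFieldTheory.Balaban1983to89
open Literature.MathematicalPhysics.QuantumFieldTheory.Balaban1983to89.Beta
open ExpKernelCalculus (MKer Decays)
open AffineAveraging (Form0 Form1 box toSite dz codiff₁ blockSum)
open AveragingContours (blk)
open OneStepResolventKernel (Fib LocStencil)
open BalabanCompositeJets (respStep)
open Summit.QuantumFields.BalabanUV.Beta.KernelWardRelative (gaugeWt)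
open Summit.QuantumFields.BalabanUV.Beta.GAN24.Push3 (push₃)
open Summit.QuantumFields.BalabanUV.Beta.GAN24.Push4Bounds (LegDecay)
open Summit.QuantumFields.BalabanUV.Beta.GAN24.Push4Iter (LegFam legChain legChain_zero legDecay_legChain)
open Summit.QuantumFields.BalabanUV.Beta.GAN24.RespStepBm (respStepBm)
open Summit.QuantumFields.BalabanUV.Beta.GAN24.RespStepBmDecompLegs (legAct legAct_apply)
open Summit.QuantumFields.BalabanUV.Beta.GAN24.RespStepBmDecompExact (respStepBmSeq respStepBmSeq_apply legAct_legChain_dz)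
open Summit.QuantumFields.BalabanUV.Beta.GAN24.RespStepBmDecomp (legDecay_respStepBm_levels)
open Summit.QuantumFields.BalabanUV.Beta.GAN24.PushRowCoarseWard (codiff₁_push₃_row_eq_smul_of_ward)

namespace Summit.QuantumFields.BalabanUV.Beta.GAN24.PushRowCoarseWardChain

variable {d : ℕ}

/-! ## §1 The coarse Ward datum of a leg family is its action on the gauge of the point indicator -/

section Indicator

open Classical in
/-- [folklore] **THE COARSE WARD DATUM AS A `legAct`** (hypothesis-free: the indicator potential has two-point support in each direction):
`Σ_α (l α (y − e_α) κ u − l α y κ u) = legAct l (dz 𝟙_{y}) κ u`. -/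
theorem sum_sub_eq_legAct_dz_indicator (l : LegFam d) (y : Fin (d + 1) → ℤ) (κ : Fin (d + 1)) (u : Fin (d + 1) → ℤ) :
    ∑ α, (l α (y - AffineAveraging.unitVec α) κ u - l α y κ u)
      = legAct l (dz (fun z => if z = y then (1 : ℝ) else 0)) κ u := by
  rw [legAct_apply]
  refine Finset.sum_congr rfl fun α _ => ?_
  set ψ : (Fin (d + 1) → ℤ) → ℝ := fun z => if z = y then (1 : ℝ) else 0 with hψ
  have hs1 : Summable fun z => ψ (z + AffineAveraging.unitVec α) * l α z κ u :=
    summable_of_ne_finset_zero (s := {y - AffineAveraging.unitVec α}) (fun z hz => by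
      rw [Finset.mem_singleton] at hz
      have hz' : z + AffineAveraging.unitVec α ≠ y := fun e => hz (by rw [← e, add_sub_cancel_right])
      simp only [hψ, if_neg hz', zero_mul])
  have hs2 : Summable fun z => ψ z * l α z κ u :=
    summable_of_ne_finset_zero (s := {y}) (fun z hz => by
      rw [Finset.mem_singleton] at hz
      simp only [hψ, if_neg hz, zero_mul])
  have e1 : ∑' z, ψ (z + AffineAveraging.unitVec α) * l α z κ u = l α (y - AffineAveraging.unitVec α) κ u := by
    rw [tsum_eq_single (y - AffineAveraging.unitVec α) (fun z hz => by
      have hz' : z + AffineAveraging.unitVec α ≠ y := fun e => hz (by rw [← e, add_sub_cancel_right])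
      simp only [hψ, if_neg hz', zero_mul])]
    simp only [hψ, sub_add_cancel, if_true, one_mul]
  have e2 : ∑' z, ψ z * l α z κ u = l α y κ u := by
    rw [tsum_eq_single y (fun z hz => by simp only [hψ, if_neg hz, zero_mul])]
    simp only [hψ, if_true, one_mul]
  symm
  calc ∑' z, dz ψ α z * l α z κ u
      = ∑' z, (ψ (z + AffineAveraging.unitVec α) * l α z κ u - ψ z * l α z κ u) :=
        tsum_congr fun z => by simp only [AffineAveraging.dz, sub_mul]
    _ = (∑' z, ψ (z + AffineAveraging.unitVec α) * l α z κ u) - ∑' z, ψ z * l α z κ u := hs1.tsum_sub hs2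
    _ = l α (y - AffineAveraging.unitVec α) κ u - l α y κ u := by rw [e1, e2]

open Classical in
/-- [folklore] **THE GAUGE OF THE LIFTED POINT INDICATOR IS THE PURE-GAUGE WEIGHT OF THE BLOCK**: `dz (𝟙_{y} ∘ blk L) κ u = gaugeWt L y κ u`
(an1's `KernelWardRelative.gaugeWt`; the two unit vectors of the tree agree, `AveragingWardStencils.b6UnitVec_eq`). -/
theorem dz_indicator_comp_blk_eq_gaugeWt (L : ℕ) (y : Fin (d + 1) → ℤ) (κ : Fin (d + 1)) (u : Fin (d + 1) → ℤ) :
    dz (fun x => if blk L x = y then (1 : ℝ) else 0) κ u = gaugeWt L y κ u := by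
  simp only [AffineAveraging.dz, KernelWardRelative.gaugeWt, AveragingWardStencils.b6UnitVec_eq]

end Indicator

/-! ## §2 The dressed leg chain obeys the coarse Ward law with the datum `L^{−(d+1)}·gaugeWt L y`, `L = Lc^{k+1}` -/

section Chain

variable {Lc : ℕ} [NeZero Lc] {rr : Fin (d + 1) → ℕ}

open Classical in
/-- NOT IN PRINT; OUR BOOKKEEPING (§1 ⨾ `RespStepBmDecomp.legAct_legChain_dz` at `ψ = 𝟙_{y}` ⨾ §1's `gaugeWt` bridge).  **THE COARSE WARD LAW OF THE DRESSED LEG CHAIN**: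
for every in-block root `toSite rr`, base level `m`, depth `k`, coarse block `y` (level `m+k+1`) and fine bond `(κ, u)` (level `m`),
`Σ_α (T α (y − e_α) κ u − T α y κ u) = (Lc^{(d+1)(k+1)})⁻¹·gaugeWt (Lc^(k+1)) y κ u`,  `T = legChain (respStepBmSeq (toSite rr) Lc) m k`
— the response of the `(k+1)`-fold dressed transport to the coarse pure-gauge datum `dᵀδ_y` is the fine pure gauge of the COMPOSITE block indicator `𝟙_{B_{Lc^{k+1}}(y)}`
with the geometric factor `(Lc^{−(d+1)})^{k+1}`, level-free in `m`. -/
theorem sum_legChain_sub_eq_gaugeWt (hrr : rr ∈ box (d + 1) Lc) (m k : ℕ) (y : Fin (d + 1) → ℤ) (κ : Fin (d + 1)) (u : Fin (d + 1) → ℤ) :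
    ∑ α, (legChain (respStepBmSeq (toSite rr) Lc) m k α (y - AffineAveraging.unitVec α) κ u
        - legChain (respStepBmSeq (toSite rr) Lc) m k α y κ u)
      = (((Lc : ℝ) ^ ((d + 1) * (k + 1)))⁻¹) * gaugeWt (Lc ^ (k + 1)) y κ u := by
  have hψs : Summable (fun z : Fin (d + 1) → ℤ => if z = y then (1 : ℝ) else 0) :=
    summable_of_ne_finset_zero (s := {y}) (fun z hz => by
      rw [Finset.mem_singleton] at hz
      simp only [if_neg hz])
  rw [sum_sub_eq_legAct_dz_indicator, legAct_legChain_dz hrr m k hψs, Pi.smul_apply, Pi.smul_apply, smul_eq_mul,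
    dz_indicator_comp_blk_eq_gaugeWt]

end Chain

/-! ## §3 The coarse row codifferential of the depth-`k` transported letter -/

section Letter

variable {Lc : ℕ} [NeZero Lc] {rr : Fin (d + 1) → ℕ}
  {S : Fin (d + 1) → (Fin (d + 1) → ℤ) → MKer (d + 1) (Fib d)} {Cs δ : ℝ}

/-- NOT IN PRINT; OUR BOOKKEEPING.  **THE CHAIN AS LEFT LEG AGAINST ARBITRARY RIGHT∕TABLE LEGS** (summable class): with `T = legChain (respStepBmSeq (toSite rr) Lc) m k`,
`codiff₁ (α x ↦ push₃ T r′ w S κ′ u′ x z′ (inl α) b) y = (Lc^{(d+1)(k+1)})⁻¹·push₃ (fun _ ↦ gaugeWt (Lc^(k+1))) r′ w S κ′ u′ y z′ (inl α₀) b`. -/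
theorem codiff₁_push₃_chainLeft_row_eq (hrr : rr ∈ box (d + 1) Lc)
    (hD : ∀ j, ∃ C m : ℝ, 0 < m ∧ LegDecay (respStep (d := d) (Lc ^ j) (Lc ^ (j + 1))) Lc C m) (m k : ℕ)
    {r' w : LegFam d} {Cw : ℝ} (hrs : ∀ β z' κ, Summable fun z => r' β z' κ z) (hw : ∀ κ' u' κ u, |w κ' u' κ u| ≤ Cw)
    (hS : LocStencil S Cs δ) (hδ : 0 < δ) (κ' : Fin (d + 1)) (u' y z' : Fin (d + 1) → ℤ) (α₀ : Fin (d + 1)) (b : Fib d) :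
    codiff₁ (fun α x => push₃ (legChain (respStepBmSeq (toSite rr) Lc) m k) r' w S κ' u' x z' (Sum.inl α) b) y
      = (((Lc : ℝ) ^ ((d + 1) * (k + 1)))⁻¹)
          * push₃ (fun _ => gaugeWt (Lc ^ (k + 1))) r' w S κ' u' y z' (Sum.inl α₀) b := by
  have hLc : 1 ≤ Lc := Nat.one_le_iff_ne_zero.2 (NeZero.ne Lc)
  have hseq : respStepBmSeq (d := d) (toSite rr) Lc = fun j => respStepBm (toSite rr) Lc (Lc ^ j) (Lc ^ (j + 1)) := by
    funext j; exact respStepBmSeq_apply (toSite rr) j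
  have hDb : ∀ j, ∃ C m : ℝ, 0 < m ∧ LegDecay (respStepBmSeq (d := d) (toSite rr) Lc j) Lc C m := fun j => by
    rw [hseq]; exact legDecay_respStepBm_levels hLc hrr hD j
  obtain ⟨CT, mT, hmT, hT⟩ := legDecay_legChain hDb m k
  exact codiff₁_push₃_row_eq_smul_of_ward (fun α x' κ x => hT.abs_le hmT.le α x' κ x) (fun α x' κ => hT.summable hmT α x' κ)
    hrs hw hS hδ (gaugeWt (Lc ^ (k + 1))) _ (sum_legChain_sub_eq_gaugeWt hrr m k) κ' u' y z' α₀ b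

/-- NOT IN PRINT; OUR BOOKKEEPING.  **THE COARSE ROW CODIFFERENTIAL OF THE DEPTH-`k` TRANSPORTED LETTER** (the (DIV)∕(DL) tower's object: by
`WardRemainderTransportedLetter.transport_unitStepMap_eq_cubic_push₃` the (REP) transport over `k+1` levels in units is `L^{3(d+1)} • push₃ T T T S`, `L = Lc^{k+1}`):
for every in-block root, base level `m`, depth `k`, `LocStencil S Cs δ` (`δ > 0`), coarse slot `(κ′, u′)`, column `(z′, b)`, row block `y`, direction `α₀`,
`codiff₁ (α x ↦ push₃ T T T S κ′ u′ x z′ (inl α) b) y = (Lc^{(d+1)(k+1)})⁻¹·push₃ (fun _ ↦ gaugeWt (Lc^(k+1))) T T S κ′ u′ y z′ (inl α₀) b`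
— `L^{−(d+1)} ×` THE GAUGE-LEFT CELL OF THE COMPOSITE-BLOCK INDICATOR (left leg `gaugeWt L y = dz 𝟙_{B_L(y)}`, supported on the bonds crossing `∂B_L(y)`). -/
theorem codiff₁_push₃_chain_row_eq (hrr : rr ∈ box (d + 1) Lc)
    (hD : ∀ j, ∃ C m : ℝ, 0 < m ∧ LegDecay (respStep (d := d) (Lc ^ j) (Lc ^ (j + 1))) Lc C m) (m k : ℕ)
    (hS : LocStencil S Cs δ) (hδ : 0 < δ) (κ' : Fin (d + 1)) (u' y z' : Fin (d + 1) → ℤ) (α₀ : Fin (d + 1)) (b : Fib d) :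
    codiff₁ (fun α x => push₃ (legChain (respStepBmSeq (toSite rr) Lc) m k) (legChain (respStepBmSeq (toSite rr) Lc) m k)
        (legChain (respStepBmSeq (toSite rr) Lc) m k) S κ' u' x z' (Sum.inl α) b) y
      = (((Lc : ℝ) ^ ((d + 1) * (k + 1)))⁻¹)
          * push₃ (fun _ => gaugeWt (Lc ^ (k + 1))) (legChain (respStepBmSeq (toSite rr) Lc) m k)
              (legChain (respStepBmSeq (toSite rr) Lc) m k) S κ' u' y z' (Sum.inl α₀) b := by
  have hLc : 1 ≤ Lc := Nat.one_le_iff_ne_zero.2 (NeZero.ne Lc)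
  have hseq : respStepBmSeq (d := d) (toSite rr) Lc = fun j => respStepBm (toSite rr) Lc (Lc ^ j) (Lc ^ (j + 1)) := by
    funext j; exact respStepBmSeq_apply (toSite rr) j
  have hDb : ∀ j, ∃ C m : ℝ, 0 < m ∧ LegDecay (respStepBmSeq (d := d) (toSite rr) Lc j) Lc C m := fun j => by
    rw [hseq]; exact legDecay_respStepBm_levels hLc hrr hD j
  obtain ⟨CT, mT, hmT, hT⟩ := legDecay_legChain hDb m k
  exact codiff₁_push₃_chainLeft_row_eq hrr hD m k (fun β z' κ => hT.summable hmT β z' κ) (fun κ' u' κ u => hT.abs_le hmT.le κ' u' κ u)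
    hS hδ κ' u' y z' α₀ b

/-! ## §4 Its `Lc`-block sum at the consumer's level -/

/-- NOT IN PRINT; OUR BOOKKEEPING.  **THE `Lc`-BLOCK SUM OF THE DEPTH-`k` LETTER's ROW CODIFFERENTIAL IS A BLOCK SUM OF GAUGE-LEFT CELLS OF COMPOSITE-BLOCK INDICATORS**:
`blockSum Lc (codiff₁ (α x ↦ push₃ T T T S κ′ u′ x z′ (inl α) b)) y₀ = (Lc^{(d+1)(k+1)})⁻¹·Σ_{v ∈ box Lc} push₃ (fun _ ↦ gaugeWt (Lc^(k+1))) T T S κ′ u′ (Lc•y₀ + toSite v) z′ (inl α₀) b`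
— the right side of leaf-03 g63's step law `WardPairingCoarseStep.stepScale_mul_pow_mul_codiff₁_multiplierCol_eq` at the consumer's level `m+k+1` for `W := push₃ T T T S κ′ u′`,
times `−(stepScale·Lc^{d+1})` (that file is not imported here). -/
theorem blockSum_codiff₁_push₃_chain_row_eq (hrr : rr ∈ box (d + 1) Lc)
    (hD : ∀ j, ∃ C m : ℝ, 0 < m ∧ LegDecay (respStep (d := d) (Lc ^ j) (Lc ^ (j + 1))) Lc C m) (m k : ℕ)
    (hS : LocStencil S Cs δ) (hδ : 0 < δ) (κ' : Fin (d + 1)) (u' y₀ z' : Fin (d + 1) → ℤ) (α₀ : Fin (d + 1)) (b : Fib d) :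
    blockSum Lc (codiff₁ (fun α x => push₃ (legChain (respStepBmSeq (toSite rr) Lc) m k) (legChain (respStepBmSeq (toSite rr) Lc) m k)
        (legChain (respStepBmSeq (toSite rr) Lc) m k) S κ' u' x z' (Sum.inl α) b)) y₀
      = (((Lc : ℝ) ^ ((d + 1) * (k + 1)))⁻¹)
          * ∑ v ∈ box (d + 1) Lc, push₃ (fun _ => gaugeWt (Lc ^ (k + 1))) (legChain (respStepBmSeq (toSite rr) Lc) m k)
              (legChain (respStepBmSeq (toSite rr) Lc) m k) S κ' u' ((Lc : ℤ) • y₀ + toSite v) z' (Sum.inl α₀) b := by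
  simp only [AffineAveraging.blockSum]
  rw [Finset.mul_sum]
  exact Finset.sum_congr rfl fun v _ => codiff₁_push₃_chain_row_eq hrr hD m k hS hδ κ' u' _ z' α₀ b

/-! ## §5 The field-leg term of a pure gauge against the depth-`k` transported letter (an2 g43's A-an2-g43-1 (2): the term `⟨m, W^F⟩` at `m = dz φ`) -/

/-- NOT IN PRINT; OUR BOOKKEEPING (an5's `KKTFluctuationEnergy.lip0_codiff₁` — `⟨dz φ, B⟩ = ⟨φ, codiff₁ B⟩` for bounded `φ`, summable `B` — ⨾ §3).  **THE FIELD-LEG TERM OF A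
PURE GAUGE AGAINST THE DEPTH-`k` TRANSPORTED LETTER IS `L^{−(d+1)} ×` THE `φ`-WEIGHTED SUM OF GAUGE-LEFT CELLS OF THE COMPOSITE-BLOCK INDICATORS**: for `φ` bounded and the
letter's rows summable in the coarse row site (displayed; `Push3.decays_push₃` discharges it),
`Σ'_y Σ_α dz φ α y · push₃ T T T S κ′ u′ y z′ (inl α) b = (Lc^{(d+1)(k+1)})⁻¹ · Σ'_y φ y · push₃ (fun _ ↦ gaugeWt (Lc^(k+1))) T T S κ′ u′ y z′ (inl α₀) b`
— the term `⟨m, W^F_{z′,b}⟩` of leaf-06's `RelInvWardPairing.ward_pairing` at `m = dz φ`, `W :=` the depth-`k` letter, which an2 g43's located answer A-an2-g43-1 (2)–(3)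
(journal l.47429) identifies as the one the (CONV-C) conversion leaves untouched. -/
theorem tsum_dz_mul_push₃_chain_row_eq (hrr : rr ∈ box (d + 1) Lc)
    (hD : ∀ j, ∃ C m : ℝ, 0 < m ∧ LegDecay (respStep (d := d) (Lc ^ j) (Lc ^ (j + 1))) Lc C m) (m k : ℕ)
    (hS : LocStencil S Cs δ) (hδ : 0 < δ) (κ' : Fin (d + 1)) (u' z' : Fin (d + 1) → ℤ) (α₀ : Fin (d + 1)) (b : Fib d)
    {φ : Form0 (d + 1) ℝ} {B : ℝ} (hφ : ∀ y, |φ y| ≤ B)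
    (hWs : ∀ α, Summable fun y => push₃ (legChain (respStepBmSeq (toSite rr) Lc) m k) (legChain (respStepBmSeq (toSite rr) Lc) m k)
        (legChain (respStepBmSeq (toSite rr) Lc) m k) S κ' u' y z' (Sum.inl α) b) :
    ∑' y, ∑ α, dz φ α y * push₃ (legChain (respStepBmSeq (toSite rr) Lc) m k) (legChain (respStepBmSeq (toSite rr) Lc) m k)
        (legChain (respStepBmSeq (toSite rr) Lc) m k) S κ' u' y z' (Sum.inl α) b
      = (((Lc : ℝ) ^ ((d + 1) * (k + 1)))⁻¹)
          * ∑' y, φ y * push₃ (fun _ => gaugeWt (Lc ^ (k + 1))) (legChain (respStepBmSeq (toSite rr) Lc) m k)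
              (legChain (respStepBmSeq (toSite rr) Lc) m k) S κ' u' y z' (Sum.inl α₀) b := by
  have h := KKTFluctuationEnergy.lip0_codiff₁ (B := fun α y => push₃ (legChain (respStepBmSeq (toSite rr) Lc) m k)
    (legChain (respStepBmSeq (toSite rr) Lc) m k) (legChain (respStepBmSeq (toSite rr) Lc) m k) S κ' u' y z' (Sum.inl α) b) hφ hWs
  unfold KKTFluctuationEnergy.lip0 KKTFluctuationEnergy.lip1 at h
  rw [← h, ← tsum_mul_left]
  refine tsum_congr fun y => ?_
  rw [codiff₁_push₃_chain_row_eq hrr hD m k hS hδ κ' u' y z' α₀ b]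
  ring

end Letter

end Summit.QuantumFields.BalabanUV.Beta.GAN24.PushRowCoarseWardChain

end
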